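import Summits.QuantumFields.YangMills.Theorems.ConvexGribovBodyBrascampLiebVacuumSCStubSliceRestriction
import Summits.QuantumFields.YangMills.Theorems.ConvexGribovBodyBrascampLiebVacuumSCStubFloorReduction
import Summits.QuantumFields.YangMills.Theorems.ConvexGribovBodyBrascampLiebVacuumSCStubOnelinkHS
import Summits.QuantumFields.YangMills.Theorems.ConvexGribovBodyBrascampLiebVacuumSCFloorCentralInvolutions

/-!
# Crux `BrascampLiebVacuumSC` (stmt-QuantumFields-16404), line `SketchIdeator1`: the crux AT a group with
# central involutions, modulo the uniform heat-bath Poincaré inequality alone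

Helper file of the line lead (`prover-line-stmt-QuantumFields-16404-c1-0`). The line's skeleton
(`Cruxes/BrascampLiebVacuumSC/Lines/SketchIdeator1.lean`, v4) composes the crux from two open stubs,
`stub_up` (UP_SC) and `stub_floorCore` (the Coulomb-gauge floor), and six landed ones. For a compact simple
`G` all of whose involutions are central (e.g. `SU(2)`, `involutions_central_su2`) the floor is a THEOREM
(`floorCore_of_involutions_central`, every `β`, every `S ≥ 1`), so at such `(G, r)` the body of
`Summit.QuantumFields.YangMills.Theses.ConvexGribovBody.BrascampLiebVacuumSC` follows from the consequent of
`stub_up` at `(G, r)` ALONE. This file records exactly that, with the crux body transcribed verbatim from the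
route file (the simple-connectivity hypothesis is not needed for this direction and is dropped):

`brascampLiebVacuumSC_at_of_up_of_involutions_central :
   IsCompactSimpleLieGroup G → (∀ g, g² = 1 → g central) → ∀ r, UP(G, r) → (crux body at (G, r))`.

Proof = the skeleton's composition `BrascampLiebVacuumSC_of` with `stub_floorCore` replaced by the landed
floor: `β₀ := β₀(UP)`, `C(β) := (2 C_UP(β) κ₁(β) + 1)/d(β)`, `Var f ≤ 2 C κ₁ dir f` (`stub_sliceRestriction` +
`stub_onelinkHS`), `d ≤ ∫ sup_h L⁻³ Σ‖A^h‖² ≤ Dmax` (`floorCore_of_involutions_central` + `stub_floorReduction`).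
Everything is proved; no named facts; nothing here asserts the crux (which quantifies over ALL simply-connected
simple `G`).
-/

set_option autoImplicit false

open scoped BigOperators Topology Matrix
open Filter MeasureTheory ProbabilityTheory
open Literature.MathematicalPhysics.QuantumFieldTheory
open Summit.QuantumFields.YangMills.Cruxes.CovarianceBound.SupportWindow
  (froSq coulombF IsCoulMin gluon modeCov supCov wilson4)
open Summit.QuantumFields.YangMills.Theorems.PoincareClustering (hbLaw hbOp)

noncomputable section

namespace Summit.QuantumFields.YangMills.Theorems.BrascampLiebVacuumSC

/-- **The crux at a group with central involutions, modulo UP alone.** For compact simple `G` with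
`g² = 1 ⇒ g` central and a faithful unitary `r`: if the uniform one-link heat-bath Poincaré inequality holds at
`(G, r)` for `β ≥ β₀` (the consequent of the line's `stub_up`), then the body of `BrascampLiebVacuumSC` holds at
`(G, r)`: for `β ≥ β₀` there are `C = (2 C_UP κ₁ + 1)/d > 0` and `S₀` with `Var_μ f ≤ C · Dmax · dir f` for every
gauge-invariant, time-zero-local, link-Lipschitz `f` on every torus `S ≥ S₀`. [folklore] -/
theorem brascampLiebVacuumSC_at_of_up_of_involutions_central :
    ∀ (G : Type) [Group G] [TopologicalSpace G] [IsTopologicalGroup G] [CompactSpace G]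
    [MeasurableSpace G] [BorelSpace G], IsCompactSimpleLieGroup G →
    (∀ g : G, g * g = 1 → g ∈ Subgroup.center G) → ∀ r : LatticeRep G,
    (∃ β₀ : ℝ, ∀ β : ℝ, β₀ ≤ β → ∃ C : ℝ, 0 ≤ C ∧ ∃ S₀ : ℕ, ∀ S : ℕ, S₀ ≤ S → ∀ F : GaugeConfig 4 (2 * S + 1) G → ℝ, Measurable F → (∃ M : ℝ, ∀ U, |F U| ≤ M) → variance F (wilson4 r β S) ≤ C * ∑ ℓ : Edge 4 (2 * S + 1), ∫ U, ∫ g, (F U - F (Function.update U ℓ g)) ^ 2 ∂(hbLaw r.ρ β ℓ U) ∂(wilson4 r β S)) →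
    ∃ β₀ : ℝ, ∀ β : ℝ, β₀ ≤ β → ∃ C : ℝ, 0 < C ∧ ∃ S₀ : ℕ, ∀ S : ℕ, S₀ ≤ S → let μ := Literature.MathematicalPhysics.QuantumFieldTheory.wilsonMeasure (d := 4) (L := 2 * S + 1) r.ρ β; let fro : Matrix (Fin r.N) (Fin r.N) ℂ → ℝ := fun M => ∑ a, ∑ b, ‖M a b‖ ^ 2; let coul : Literature.MathematicalPhysics.QuantumFieldTheory.GaugeConfig 4 (2 * S + 1) G → (Literature.MathematicalPhysics.QuantumFieldTheory.Site 4 (2 * S + 1) → G) → ℝ := fun U h => -∑ e : Literature.MathematicalPhysics.QuantumFieldTheory.Edge 4 (2 * S + 1), (if e.1 0 = 0 ∧ e.2 ≠ 0 then (r.ρ (Literature.MathematicalPhysics.QuantumFieldTheory.gaugeTransform h U e)).trace.re else 0); let cov : Literature.MathematicalPhysics.QuantumFieldTheory.GaugeConfig 4 (2 * S + 1) G → (Literature.MathematicalPhysics.QuantumFieldTheory.Site 4 (2 * S + 1) → G) → (Fin 3 → ZMod (2 * S + 1)) → ℝ := fun U h p => (∑ j : Fin 3, fro (∑ y : Fin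 3 → ZMod (2 * S + 1), Complex.exp (-(2 * Real.pi * Complex.I * (∑ i : Fin 3, ((p i).val : ℂ) * ((y i).val : ℂ)) / (2 * S + 1 : ℂ))) • ((1 / 2 : ℂ) • (r.ρ (Literature.MathematicalPhysics.QuantumFieldTheory.gaugeTransform h U (Fin.cons (0 : ZMod (2 * S + 1)) y, j.succ)) - (r.ρ (Literature.MathematicalPhysics.QuantumFieldTheory.gaugeTransform h U (Fin.cons (0 : ZMod (2 * S + 1)) y, j.succ)))ᴴ)))) / ((2 * S + 1 : ℝ) ^ 3); let Dmax : ℝ := ⨆ p : Fin 3 → ZMod (2 * S + 1), ∫ U, (⨆ h : {h : Literature.MathematicalPhysics.QuantumFieldTheory.Site 4 (2 * S + 1) → G // ∀ h', coul U h ≤ coul U h'}, cov U h.1 p) ∂μ; let slope : (Literature.MathematicalPhysics.QuantumFieldTheory.GaugeConfig 4 (2 * S + 1) G → ℝ) → Literature.MathematicalPhysics.QuantumFieldTheory.GaugeConfig 4 (2 * S + 1) G → Literature.MathematicalPhysics.QuantumFieldTheory.Edge 4 (2 * S + 1) → ℝ := fun f U e => Filter.limsup (fun g : G => |f (Function.update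 U e g) - f U| / Real.sqrt (fro (r.ρ g - r.ρ (U e)))) (𝓝[≠] (U e)); let dir : (Literature.MathematicalPhysics.QuantumFieldTheory.GaugeConfig 4 (2 * S + 1) G → ℝ) → ℝ := fun f => ∑ e : Literature.MathematicalPhysics.QuantumFieldTheory.Edge 4 (2 * S + 1), (if e.1 0 = 0 ∧ e.2 ≠ 0 then ∫ U, (slope f U e) ^ 2 ∂μ else 0); ∀ f : Literature.MathematicalPhysics.QuantumFieldTheory.GaugeConfig 4 (2 * S + 1) G → ℝ, Literature.MathematicalPhysics.QuantumFieldTheory.IsGaugeInvariant f → (∀ U V : Literature.MathematicalPhysics.QuantumFieldTheory.GaugeConfig 4 (2 * S + 1) G, (∀ e : Literature.MathematicalPhysics.QuantumFieldTheory.Edge 4 (2 * S + 1), e.1 0 = 0 → e.2 ≠ 0 → U e = V e) → f U = f V) → (∃ K : ℝ, ∀ U V : Literature.MathematicalPhysics.QuantumFieldTheory.GaugeConfig 4 (2 * S + 1) G, |f U - f V| ≤ K * ∑ e, Real.sqrt (fro (r.ρ (U e) - r.ρ (V e)))) → ∫ U, (f U - ∫ V, f V ∂μ) ^ 2 ∂μ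 ≤ C * Dmax * dir f := by
  intro G _ _ _ _ _ _ hG hJ r hUP
  obtain ⟨β₁, h₁⟩ := hUP
  refine ⟨β₁, fun β hβ => ?_⟩
  obtain ⟨C, hC0, S₁, hUP'⟩ := h₁ β hβ
  obtain ⟨κ₁, hκ0, hHS⟩ := stub_onelinkHS G hG r β
  obtain ⟨d, hd, hfl⟩ := floorCore_of_involutions_central G hG hJ r β
  refine ⟨(2 * C * κ₁ + 1) / d, by positivity, max S₁ 1, fun S hS => ?_⟩
  intro μ fro coul cov Dmax slope dir f hf₁ hf₂ hf₃
  have hA : ∫ U, (f U - ∫ V, f V ∂μ) ^ 2 ∂μ ≤ 2 * C * κ₁ * dir f :=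
    stub_sliceRestriction G r β C κ₁ S hC0 hκ0 (hUP' S (le_trans (le_max_left _ _) hS)) (hHS S)
      f hf₁ hf₂ hf₃
  have hred : ∫ U, (⨆ h : {h : Site 4 (2 * S + 1) → G // IsCoulMin r S U h},
      (∑ j : Fin 3, ∑ y : Fin 3 → ZMod (2 * S + 1), froSq (gluon r S U h.1 y j)) /
        ((2 * S + 1 : ℝ) ^ 3)) ∂(wilson4 r β S) ≤ Dmax :=
    stub_floorReduction G r β S
  have hcore := hfl S (le_trans (le_max_right _ _) hS)
  have hDmax : d ≤ Dmax := hcore.trans hred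
  have hdir : 0 ≤ dir f := by
    refine Finset.sum_nonneg fun e _ => ?_
    split_ifs
    · exact integral_nonneg fun U => sq_nonneg _
    · exact le_rfl
  have hCκ : 0 ≤ 2 * C * κ₁ := by positivity
  refine hA.trans ?_
  have h1 : 2 * C * κ₁ ≤ (2 * C * κ₁ + 1) / d * Dmax := by
    rw [div_mul_eq_mul_div, le_div_iff₀ hd]
    nlinarith [mul_le_mul_of_nonneg_left hDmax (by positivity : (0 : ℝ) ≤ 2 * C * κ₁ + 1)]
  exact mul_le_mul_of_nonneg_right h1 hdir

end Summit.QuantumFields.YangMills.Theorems.BrascampLiebVacuumSC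

end
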